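import Literature.Analysis.FluidPDE.NSLerayHopfABCScaling
import Literature.Analysis.FluidPDE.DistributionalToWeak
import Literature.Analysis.FluidPDE.HeatDuhamelBack
import Literature.Analysis.FluidPDE.ClassicalSuitable
import Literature.Analysis.FluidPDE.LerayHopfProofs
import Literature.Analysis.FluidPDE.SereginZajaczkowski2007SwirlRotation
import Literature.Analysis.FluidPDE.AxisymVorticityAlgebra
import Literature.Analysis.FluidPDE.EnstrophyGronwall
import Literature.Analysis.FluidPDE.WholeSpaceIBP
import Literature.MeasureTheory.Lebesgue.ThickPartition
import Mathlib.Analysis.SpecialFunctions.JapaneseBracket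
import Mathlib.MeasureTheory.Measure.SeparableMeasure
import HarnessLib

/-!
# The tree's rendering of `albritton_brue_colombo` (ns.S20) is vacuous — a witness, not a discharge

Analysis/FluidPDE. This file proves `ABCVacuity.rendering_is_vacuous`, whose statement is —
written out in full — the body of the named fact `albritton_brue_colombo` (`NSLerayHopf.lean`,
**ns.S20**, cited to Albritton–Brué–Colombo, Ann. of Math. 196 (2022), Thm. 1.1 =
arXiv:2112.03116, Def. 1.1 + Thm. 1.2), and `ABCVacuity.unit_rendering_is_vacuous`, the body of
`albritton_brue_colombo_unit` **as first vendored** (`NSLerayHopfABCScaling.lean`, p25167: the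
literal `ν = 1` instance of `albritton_brue_colombo`; that fact has since been RESTATED with the
measurability clause of the section "The faithful statement" below — 2026-08-15, review of the
ns.S20 decomposition — so the statement spelled out in `unit_rendering_is_vacuous` is now the
*retired* unit-viscosity rendering, kept here written out in full exactly as the precedent
`DistributionalToWeakCounterexample.lean` keeps its retired statement). **It does not formalise the
Albritton–Brué–Colombo construction** (unstable self-similar vortex ring, spectral perturbation,
nonlinear instability), and it deliberately does NOT discharge any named fact (no `_holds`
theorem; review of p32345): it shows that the tree's unguarded rendering of the theorem is
provable by an elementary degenerate example, i.e. that the rendering is *weaker than the printed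
theorem* — a statement defect of the same family as the two retired facts documented in
`WeakSolution.lean` (non-measurable data seen through Bochner integrals), repaired the same way
(retire the rendering, vendor the corrected statement: done for `albritton_brue_colombo_unit`;
the every-viscosity `albritton_brue_colombo` of `NSLerayHopf.lean` still carries the unguarded
rendering witnessed here and awaits the planner).

## The defect

The printed theorem (arXiv Thm. 1.2, with Def. 1.1): *there exist `T > 0`,
`f ∈ L¹_t L²_x(ℝ³ × (0,T))`, and two distinct suitable Leray–Hopf solutions on `ℝ³ × (0,T)` with
body force `f` and initial condition `u₀ ≡ 0`.* Here `f ∈ L¹_t L²_x` is an element of a Bochner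
space: `t ↦ f(t)` is (strongly) measurable. The tree renders "`f ∈ L¹(0,T; L²)`" as
`MemLqLp 1 2 f (Ioo 0 T)` (`LerayHopf.lean`), which by design guards only the *slices*
(`f t ∈ L²` for a.e. `t`, and a finite lower integral `∫⁻ ‖f t‖₂ dt`) and demands **no
measurability of `t ↦ f t`** ("v0 simplification", loc. cit.) — harmless for a solution `u`,
which `IsWeakNSSolutionOn` separately requires to be jointly measurable, but fatal for an
existentially quantified force: the force enters `IsWeakNSSolutionOn` / `IsLerayHopfOn` only
through the Bochner integrals `∫ t in Ioo 0 T, ∫ x, (… + ⟪f t x, ψ t x⟫)` (weak identity) and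
`∫ τ in s..t, ∫ x, ⟪f τ x, u τ x⟫` (energy inequality), and Mathlib's Bochner integral of an
integrand which is not a.e.-strongly measurable is the junk value `0`
(`MeasureTheory.integral_non_aestronglyMeasurable`).

## The degenerate example (`namespace ABCVacuity`)

For any `ν`, on `[0, 1)`:
* `W x = (1 + ‖x‖²)⁻² (−x₁, x₀, 0)` (`ABCVacuity.W`): smooth, divergence free, in `L² ∩ Ḣ¹`,
  nowhere zero off the `x₂`-axis — in particular not a.e. equal to a compactly supported field
  (`not_ae_W_eq_zero_far`), so that no test-field slice is a multiple of `W`;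
* directions `E 0 = 0`, `E (n+1) ∈ W^⊥ ⊆ L²`, `‖E n‖₂ ≤ 1`, built from a dense sequence of
  `L²(ℝ³; ℝ³)` (`Lp.SecondCountableTopology`), with the richness property: a continuous compactly
  supported field orthogonal to all `E (n+1)` is `0` (`eq_zero_of_forall_integral_inner_Edir`);
* a class map `k : ℝ → ℕ` all of whose fibres have FULL OUTER Lebesgue measure
  (`Literature/MeasureTheory/Lebesgue/ThickPartition.lean`: translates of a `ℚ`-hyperplane of a
  Hamel basis; Kharazishvili 2005, Ch. 9 Ex. 6; Halmos 1950, §§16–17);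
* the force `f t = p(t) W + E (k t)` with the honest amplitude `p(t) = 1 + ν t m₁/m₀`
  (`m₀ = ‖W‖₂²`, `m₁ = ‖∇W‖₂²`); `MemLqLp 1 2 f (Ioo 0 1)` holds (`memLqLp_force`: slices in `L²`,
  norms bounded) although `t ↦ f t` is not measurable in any reasonable sense;
* the two "solutions" `u ≡ 0` and `v t = t W`.

`ABCVacuity.weak_identity`: for EVERY jointly continuous velocity field `w` the weak identity
with force `f` and datum `0` holds. Indeed, for a test field `ψ` put `e_n(t) = ∫ ⟪E n, ψ t⟫`; the
slice integrand is `Φ(t) + e_{k(t)}(t)` with `Φ` measurable. If `t ↦ e_{k(t)}(t)` is not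
a.e.-strongly measurable on `(0,1)`, neither is the slice integrand and its time integral is the
junk `0`; if it is, thickness of the fibres forces `e_n = e_0 = 0` a.e. for all `n`
(`ThickPartition.ae_eq_of_aestronglyMeasurable_lift`), so `ψ t = 0` for a.e., hence every,
`t ∈ (0,1)` and the integrand vanishes identically. Everything else is honest: `v` has weak
gradient `t ∇W`, the forcing power is `∫ ⟪f τ, v τ⟫ = τ p(τ) m₀` (`E (k τ) ⟂ W`), and with this
`p` the energy inequality of `v` is an identity (`energy_ineq_vel`); `u ≡ 0` is trivially
Leray–Hopf; `v(1/2) = W/2 ≠ 0` a.e. Hence `ABCVacuity.rendering_is_vacuous`.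

## The faithful statement (not vendored here) and the status of the two facts

The printed theorem needs, in the tree's vocabulary, the extra clause
`AEStronglyMeasurable (uncurry f) (volume.restrict (Ioo 0 T ×ˢ univ))` on the force — exactly the
measurability clause the tree's `hopf_existence_torus` (`NSLerayHopf.lean`) already imposes on its
force — under which `t ↦ ∫ ⟪f t, ψ t⟫` is integrable and the example above collapses. That
corrected rendering of Albritton–Brué–Colombo 2022, Thm. 1.2 remains a deep, undischarged
formalisation target; per D-0026 it is not minted as a new named fact in this (provefact) file.
*Status (2026-08-15):* the unit-viscosity fact `albritton_brue_colombo_unit`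
(`NSLerayHopfABCScaling.lean`) has been restated with exactly this clause (and its faithful
every-viscosity form is the right-hand side of `albritton_brue_colombo_unit_iff_forall_viscosity`
there); the every-viscosity `albritton_brue_colombo` (`NSLerayHopf.lean`) is unchanged and its
retirement is left to the planner. No statement is edited from this file, and no fact is
discharged here.

## Mathlib / tree search

Tree: `albritton_brue_colombo` has no dependents (`lean search`); `albritton_brue_colombo_unit`,
`albritton_brue_colombo_of_unit`, `albritton_brue_colombo_unit_iff_forall_viscosity`
(`NSLerayHopfABCScaling.lean`). Reused: `rotGen`/`rotGenL`
(`SwirlTransportProofs`), `SereginZajaczkowski2007.divergence_smul_rotGen`, `norm_rotGen_sq`,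
`frobeniusNormSq_le_three_mul`, `hasWeakGradient_fderiv_of_contDiff`,
`IsDivFree.isWeaklyDivFree_holds`, `integrable_inner_of_memLp_two`, the test-field calculus of
`ClassicalSolutionCalculus` / `ClassicalSuitable` / `HeatDuhamelBack`, `volume_Ioo_prod_lt_top`.
Mathlib: `integral_non_aestronglyMeasurable`, `Lp.SecondCountableTopology`,
`TopologicalSpace.exists_dense_seq`, `L2.inner_def`, `integrable_rpow_neg_one_add_norm_sq`,
`StronglyMeasurable.integral_prod_right'`, `Real.measure_ext_Ioo_rat` (via `ThickPartition`).
The honest decomposition line towards the theorem itself lives in `NSLerayHopfABCAssembly.lean`,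
`NSLerayHopfABCContraction.lean`, `LerayHopfForcedOpenStrip*.lean` (not imported here).

## References

* D. Albritton, E. Brué, M. Colombo, *Non-uniqueness of Leray solutions of the forced
  Navier–Stokes equations*, Ann. of Math. 196 (2022) 415–455 = arXiv:2112.03116 (held:
  `paper:arxiv-2112.03116`), Def. 1.1 (`f ∈ L¹_t L²_x(ℝ³ × (0,T))`), Thm. 1.2 (PDF p. 3).
  [AlbrittonBrueColombo2022]
* A. B. Kharazishvili, *Strange Functions in Real Analysis* (2005), Ch. 9, Exercise 6.
  [Kharazishvili2005]
* P. R. Halmos, *Measure Theory* (1950), §16 Thm. E, §17. [Halmos1950]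
-/

noncomputable section

open MeasureTheory TopologicalSpace Set Function Filter Metric Topology
open scoped InnerProductSpace RealInnerProductSpace ENNReal NNReal Laplacian

namespace Literature.Analysis.FluidPDE

namespace ABCVacuity

local notation "ℝ³" => EuclideanSpace ℝ (Fin 3)

/-! ### The profile `W x = (1 + ‖x‖²)⁻² J x` -/

/-- The radial weight `(1 + ‖x‖²)⁻²`. [folklore] -/
def wt (x : ℝ³) : ℝ := ((1 + ‖x‖ ^ 2) ^ 2)⁻¹

/-- The profile `W x = (1 + ‖x‖²)⁻² (−x₁, x₀, 0)` = `(1 + ‖x‖²)⁻² J x`: a smooth, divergence-free,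
square-integrable field with square-integrable gradient, vanishing only on the `x₂`-axis. [folklore] -/
def W (x : ℝ³) : ℝ³ := wt x • rotGen x

/-- The weight is positive. [folklore] -/
theorem wt_pos (x : ℝ³) : 0 < wt x := by unfold wt; positivity

/-- The weight is smooth (`(1 + ‖x‖²)²` is smooth and never vanishes). [folklore] -/
theorem contDiff_wt {n : WithTop ℕ∞} : ContDiff ℝ n wt := by
  unfold wt
  refine ContDiff.inv ?_ (fun x => ?_)
  · exact (contDiff_const.add (contDiff_norm_sq ℝ)).pow 2
  · positivity

/-- The profile is smooth. [folklore] -/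
theorem contDiff_W {n : WithTop ℕ∞} : ContDiff ℝ n W := contDiff_wt.smul contDiff_rotGen

/-- The profile is continuous. [folklore] -/
theorem continuous_W : Continuous W := contDiff_W (n := 0) |>.continuous

/-- The derivative of the weight: `D wt(x) = -2(1+‖x‖²)⁻³ · 2⟪x, ·⟫` (chain rule). [folklore] -/
theorem hasFDerivAt_wt (x : ℝ³) :
    HasFDerivAt wt ((-2 * ((1 + ‖x‖ ^ 2) ^ 3)⁻¹) • ((2 : ℝ) • innerSL ℝ x)) x := by
  have hpos : 0 < 1 + ‖x‖ ^ 2 := by positivity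
  have hg : HasDerivAt (fun s : ℝ => ((1 + s) ^ 2)⁻¹) (-2 * ((1 + ‖x‖ ^ 2) ^ 3)⁻¹) (‖x‖ ^ 2) := by
    have h1 : HasDerivAt (fun s : ℝ => (1 + s) ^ 2) (2 * (1 + ‖x‖ ^ 2)) (‖x‖ ^ 2) := by
      simpa [Pi.pow_def] using ((hasDerivAt_id (‖x‖ ^ 2)).const_add 1).pow 2
    have h2 := h1.fun_inv (by positivity)
    have heq : -(2 * (1 + ‖x‖ ^ 2)) / ((1 + ‖x‖ ^ 2) ^ 2) ^ 2 = -2 * ((1 + ‖x‖ ^ 2) ^ 3)⁻¹ := by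
      rw [div_eq_iff (by positivity)]
      field_simp
    rw [heq] at h2
    exact h2
  have hn : HasFDerivAt (fun y : ℝ³ => ‖y‖ ^ 2) ((2 : ℝ) • innerSL ℝ x) x := by
    have := (hasStrictFDerivAt_norm_sq x).hasFDerivAt
    rw [← Nat.cast_smul_eq_nsmul ℝ, Nat.cast_ofNat] at this
    exact this
  have hcomp : wt = (fun s : ℝ => ((1 + s) ^ 2)⁻¹) ∘ (fun y : ℝ³ => ‖y‖ ^ 2) := rfl
  rw [hcomp]
  exact hg.comp_hasFDerivAt x hn

/-- `‖D wt(x)‖ = 4‖x‖(1+‖x‖²)⁻³`. [folklore] -/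
theorem norm_fderiv_wt (x : ℝ³) : ‖fderiv ℝ wt x‖ = 4 * ‖x‖ * ((1 + ‖x‖ ^ 2) ^ 3)⁻¹ := by
  have hpos : 0 < ((1 + ‖x‖ ^ 2) ^ 3)⁻¹ := by positivity
  rw [(hasFDerivAt_wt x).fderiv]
  simp only [norm_smul, Real.norm_eq_abs, abs_mul, abs_neg, abs_two, abs_of_nonneg hpos.le,
    innerSL_apply_norm]
  ring

/-- The derivative of the profile (product rule): `DW(x) = wt(x) J + Dwt(x) ⊗ Jx`. [folklore] -/
theorem hasFDerivAt_W (x : ℝ³) :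
    HasFDerivAt W (wt x • rotGenL + (fderiv ℝ wt x).smulRight (rotGen x)) x :=
  (hasFDerivAt_wt x).differentiableAt.hasFDerivAt.smul (hasFDerivAt_rotGen x)

/-- `‖Jv‖ ≤ ‖v‖`. [folklore] -/
theorem norm_rotGen_le (v : ℝ³) : ‖rotGen v‖ ≤ ‖v‖ := by
  have h : ‖rotGen v‖ ^ 2 ≤ ‖v‖ ^ 2 := by
    rw [norm_rotGen_sq, EuclideanSpace.norm_sq_eq]
    simp only [Real.norm_eq_abs, sq_abs, Fin.sum_univ_three]
    nlinarith [sq_nonneg (v 2)]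
  exact (pow_le_pow_iff_left₀ (norm_nonneg _) (norm_nonneg _) two_ne_zero).1 h

/-- The constant `K = ‖J‖ + 4` in the gradient bound. [folklore] -/
def KW : ℝ := ‖rotGenL‖ + 4

/-- The constant is nonnegative. [folklore] -/
theorem KW_nonneg : 0 ≤ KW := by unfold KW; positivity

/-- The gradient bound `‖DW(x)‖ ≤ K (1+‖x‖²)⁻²`. [folklore] -/
theorem norm_fderiv_W_le (x : ℝ³) : ‖fderiv ℝ W x‖ ≤ KW * ((1 + ‖x‖ ^ 2) ^ 2)⁻¹ := by
  set a : ℝ := 1 + ‖x‖ ^ 2 with ha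
  have hapos : 0 < a := by positivity
  rw [(hasFDerivAt_W x).fderiv]
  calc ‖wt x • rotGenL + (fderiv ℝ wt x).smulRight (rotGen x)‖
      ≤ ‖wt x • rotGenL‖ + ‖(fderiv ℝ wt x).smulRight (rotGen x)‖ := norm_add_le _ _
    _ = wt x * ‖rotGenL‖ + ‖fderiv ℝ wt x‖ * ‖rotGen x‖ := by
        rw [norm_smul, Real.norm_eq_abs, abs_of_pos (wt_pos x),
          ContinuousLinearMap.norm_smulRight_apply]
    _ ≤ wt x * ‖rotGenL‖ + ‖fderiv ℝ wt x‖ * ‖x‖ := by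
        gcongr; exact norm_rotGen_le x
    _ = (a ^ 2)⁻¹ * ‖rotGenL‖ + 4 * (a ^ 2)⁻¹ * (‖x‖ ^ 2 / a) := by
        rw [norm_fderiv_wt, wt, ← ha]
        field_simp
    _ ≤ (a ^ 2)⁻¹ * ‖rotGenL‖ + 4 * (a ^ 2)⁻¹ * 1 := by
        gcongr
        rw [div_le_one hapos, ha]
        linarith
    _ = KW * (a ^ 2)⁻¹ := by unfold KW; ring

/-- The Frobenius bound `|∇W(x)|² ≤ 3K²(1+‖x‖²)⁻⁴` on the gradient of the profile. [folklore] -/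
theorem frobeniusNormSq_fderiv_W_le (x : ℝ³) :
    frobeniusNormSq (fderiv ℝ W x) ≤ 3 * KW ^ 2 * ((1 + ‖x‖ ^ 2) ^ 4)⁻¹ := by
  have h1 := frobeniusNormSq_le_three_mul (fderiv ℝ W x)
  have h2 := norm_fderiv_W_le x
  have h3 : ‖fderiv ℝ W x‖ ^ 2 ≤ (KW * ((1 + ‖x‖ ^ 2) ^ 2)⁻¹) ^ 2 :=
    pow_le_pow_left₀ (norm_nonneg _) h2 2
  calc frobeniusNormSq (fderiv ℝ W x) ≤ 3 * ‖fderiv ℝ W x‖ ^ 2 := h1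
    _ ≤ 3 * (KW * ((1 + ‖x‖ ^ 2) ^ 2)⁻¹) ^ 2 := by gcongr
    _ = 3 * KW ^ 2 * ((1 + ‖x‖ ^ 2) ^ 4)⁻¹ := by
        have : (0 : ℝ) < 1 + ‖x‖ ^ 2 := by positivity
        field_simp

/-- `‖W x‖ ≤ ‖x‖(1+‖x‖²)⁻²`. [folklore] -/
theorem norm_W_le (x : ℝ³) : ‖W x‖ ≤ ‖x‖ * ((1 + ‖x‖ ^ 2) ^ 2)⁻¹ := by
  unfold W
  rw [norm_smul, Real.norm_eq_abs, abs_of_pos (wt_pos x), wt, mul_comm]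
  gcongr
  exact norm_rotGen_le x

/-- `‖W x‖² ≤ (1+‖x‖²)⁻³`. [folklore] -/
theorem norm_W_sq_le (x : ℝ³) : ‖W x‖ ^ 2 ≤ ((1 + ‖x‖ ^ 2) ^ 3)⁻¹ := by
  set a : ℝ := 1 + ‖x‖ ^ 2 with ha
  have hapos : 0 < a := by positivity
  have h1 := norm_W_le x
  rw [← ha] at h1
  have h2 : ‖W x‖ ^ 2 ≤ (‖x‖ * (a ^ 2)⁻¹) ^ 2 := pow_le_pow_left₀ (norm_nonneg _) h1 2
  calc ‖W x‖ ^ 2 ≤ (‖x‖ * (a ^ 2)⁻¹) ^ 2 := h2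
    _ = (a ^ 3)⁻¹ * (‖x‖ ^ 2 / a) := by field_simp
    _ ≤ (a ^ 3)⁻¹ * 1 := by
        gcongr
        rw [div_le_one hapos, ha]
        linarith
    _ = (a ^ 3)⁻¹ := mul_one _

/-! ### Integrability -/

/-- `(1 + ‖x‖²)^(-k)` is integrable on `ℝ³` for a natural number `k ≥ 2` (Mathlib's
`integrable_rpow_neg_one_add_norm_sq`, `2k > 3 = dim`). [folklore] -/
theorem integrable_inv_one_add_norm_sq_pow {k : ℕ} (hk : 2 ≤ k) :
    Integrable (fun x : ℝ³ => ((1 + ‖x‖ ^ 2) ^ k)⁻¹) (volume : Measure ℝ³) := by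
  have hfin : (Module.finrank ℝ ℝ³ : ℝ) < 2 * k := by
    rw [finrank_euclideanSpace_fin]
    have : (2 : ℝ) ≤ k := by exact_mod_cast hk
    push_cast
    linarith
  have h := integrable_rpow_neg_one_add_norm_sq (E := ℝ³) (μ := volume) hfin
  refine h.congr (Eventually.of_forall fun x => ?_)
  have hpos : 0 < 1 + ‖x‖ ^ 2 := by positivity
  simp only
  rw [show -(2 * (k : ℝ)) / 2 = -(k : ℝ) by ring, Real.rpow_neg hpos.le, Real.rpow_natCast]

/-- `W ∈ L²(ℝ³)` (`‖W‖² ≤ (1+‖x‖²)⁻³`, integrable on `ℝ³`). [folklore] -/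
theorem memLp_W : MemLp W 2 (volume : Measure ℝ³) := by
  refine (memLp_two_iff_integrable_sq_norm continuous_W.aestronglyMeasurable).2 ?_
  refine (integrable_inv_one_add_norm_sq_pow (k := 3) (by norm_num)).mono'
    (continuous_W.norm.pow 2).aestronglyMeasurable (Eventually.of_forall fun x => ?_)
  rw [Real.norm_eq_abs, abs_of_nonneg (sq_nonneg _)]
  exact norm_W_sq_le x

/-- `|∇W|² ∈ L¹(ℝ³)` (`≤ 3K²(1+‖x‖²)⁻⁴`). [folklore] -/
theorem integrable_frobeniusNormSq_fderiv_W :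
    Integrable (fun x => frobeniusNormSq (fderiv ℝ W x)) (volume : Measure ℝ³) := by
  have hc : Continuous fun x => frobeniusNormSq (fderiv ℝ W x) :=
    LerayHopfProofs.continuous_frobeniusNormSq.comp
      ((contDiff_W (n := 1)).continuous_fderiv one_ne_zero)
  refine ((integrable_inv_one_add_norm_sq_pow (k := 4) (by norm_num)).const_mul
    (3 * KW ^ 2)).mono' hc.aestronglyMeasurable (Eventually.of_forall fun x => ?_)
  rw [Real.norm_eq_abs, abs_of_nonneg (frobeniusNormSq_nonneg _)]
  exact frobeniusNormSq_fderiv_W_le x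

/-- `∫⁻ |∇W|² < ∞`. [folklore] -/
theorem lintegral_frobeniusNormSq_fderiv_W_lt_top :
    ∫⁻ x, ENNReal.ofReal (frobeniusNormSq (fderiv ℝ W x)) ∂(volume : Measure ℝ³) < ⊤ := by
  have h := integrable_frobeniusNormSq_fderiv_W.hasFiniteIntegral
  rw [hasFiniteIntegral_iff_ofReal (Eventually.of_forall fun x => frobeniusNormSq_nonneg _)] at h
  exact h

/-! ### Divergence, weak divergence, weak gradient -/

/-- `div W = 0`: `div (wt J) = ⟪J x, ∇wt⟫` (`div J = 0`) and `∇wt(x) ∥ x ⟂ J x`. [folklore] -/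
theorem isDivFree_W : VectorCalculus.IsDivFree W := by
  intro x
  show VectorCalculus.divergence (fun y => wt y • rotGen y) x = 0
  rw [SereginZajaczkowski2007.divergence_smul_rotGen
    ((contDiff_wt (n := 1)).differentiable one_ne_zero x)]
  rw [inner_gradient_right_eq_fderiv, (hasFDerivAt_wt x).fderiv]
  simp [SereginZajaczkowski2007.inner_rotGen_right, inner_rotGen_self]

/-- `W` is weakly divergence free (`C¹` and divergence free). [folklore] -/
theorem isWeaklyDivFree_W : IsWeaklyDivFree W :=
  VectorCalculus.IsDivFree.isWeaklyDivFree_holds isDivFree_W (contDiff_W (n := 1))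

/-- The classical gradient of `W` is a weak gradient. [folklore] -/
theorem hasWeakGradient_W : HasWeakGradient W (fderiv ℝ W) :=
  hasWeakGradient_fderiv_of_contDiff (contDiff_W (n := 1))

/-! ### Non-vanishing far out -/

/-- `W x ≠ 0` off the plane `x₀ = 0` (its second component is `wt(x) x₀`). [folklore] -/
theorem W_ne_zero_of {x : ℝ³} (hx : x 0 ≠ 0) : W x ≠ 0 := by
  intro h
  have h1 : (W x) 1 = 0 := by rw [h]; rfl
  have h2 : (W x) 1 = wt x * x 0 := by
    show (wt x • rotGen x) 1 = wt x * x 0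
    simp
  rw [h2] at h1
  rcases mul_eq_zero.1 h1 with h3 | h3
  · exact (wt_pos x).ne' h3
  · exact hx h3

/-- **`W` does not vanish a.e. outside any ball**: the open set `{‖x‖ > R, x₀ ≠ 0}` is non-empty
and `W ≠ 0` there. Hence `W` is not a.e. equal to any compactly supported field. [folklore] -/
theorem not_ae_W_eq_zero_far (R : ℝ) : ¬ (∀ᵐ x ∂(volume : Measure ℝ³), R < ‖x‖ → W x = 0) := by
  intro h
  set U : Set ℝ³ := {x | R < ‖x‖ ∧ x 0 ≠ 0} with hU
  have hUo : IsOpen U := by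
    refine (isOpen_lt continuous_const continuous_norm).inter ?_
    exact isOpen_ne_fun (EuclideanSpace.proj (0 : Fin 3)).continuous continuous_const
  set R' : ℝ := |R| + 1 with hR'
  have hR'pos : 0 < R' := by positivity
  have hmem : EuclideanSpace.single (0 : Fin 3) R' ∈ U := by
    refine ⟨?_, ?_⟩
    · rw [PiLp.norm_single, Real.norm_eq_abs, abs_of_pos hR'pos, hR']
      linarith [le_abs_self R]
    · simp [hR'pos.ne']
  have hUpos : 0 < volume U := hUo.measure_pos volume ⟨_, hmem⟩
  have hU0 : volume U = 0 := by
    rw [ae_iff] at h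
    refine measure_mono_null (fun x hx => ?_) h
    simp only [Classical.not_imp, mem_setOf_eq]
    exact ⟨hx.1, W_ne_zero_of hx.2⟩
  exact hUpos.ne' hU0

/-- The `L²` mass `∫ ‖W‖²` is positive (`W ≠ 0` on the open set `{x₀ ≠ 0}`). [folklore] -/
theorem integral_norm_sq_W_pos : 0 < ∫ x, ‖W x‖ ^ 2 ∂(volume : Measure ℝ³) := by
  have hint : Integrable (fun x => ‖W x‖ ^ 2) (volume : Measure ℝ³) :=
    (memLp_two_iff_integrable_sq_norm continuous_W.aestronglyMeasurable).1 memLp_W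
  rw [integral_pos_iff_support_of_nonneg (fun x => sq_nonneg _) hint]
  set U : Set ℝ³ := {x | x 0 ≠ 0} with hU
  have hUo : IsOpen U := isOpen_ne_fun (EuclideanSpace.proj (0 : Fin 3)).continuous continuous_const
  have hmem : EuclideanSpace.single (0 : Fin 3) (1 : ℝ) ∈ U := by simp [hU]
  have hUpos : 0 < volume U := hUo.measure_pos volume ⟨_, hmem⟩
  refine hUpos.trans_le (measure_mono fun x hx => ?_)
  rw [mem_support]
  exact pow_ne_zero 2 (norm_ne_zero_iff.2 (W_ne_zero_of hx))

/-! #### Constants of the profile -/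

/-- The `L²` mass `m₀ = ∫ ‖W‖²` of the profile. [folklore] -/
def m₀ : ℝ := ∫ x, ‖W x‖ ^ 2

/-- `m₀ > 0`. [folklore] -/
theorem m₀_pos : 0 < m₀ := integral_norm_sq_W_pos

/-- The dissipation constant `m₁ = ∫ |∇W|²` of the profile. [folklore] -/
def m₁ : ℝ := ∫ x, frobeniusNormSq (fderiv ℝ W x)

/-- `m₁ ≥ 0`. [folklore] -/
theorem m₁_nonneg : 0 ≤ m₁ := integral_nonneg fun _ => frobeniusNormSq_nonneg _

/-- `∫ ⟪W, W⟫ = m₀`. [folklore] -/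
theorem integral_inner_W_W : ∫ x, ⟪W x, W x⟫ = m₀ := by
  simp_rw [real_inner_self_eq_norm_sq]; rfl

/-- `‖W x‖ ≤ 1`. [folklore] -/
theorem norm_W_le_one (x : ℝ³) : ‖W x‖ ≤ 1 := by
  have h1 := norm_W_sq_le x
  have h2 : ((1 + ‖x‖ ^ 2) ^ 3)⁻¹ ≤ 1 := by
    rw [inv_le_one_iff₀]
    exact Or.inr (one_le_pow₀ (by nlinarith [norm_nonneg x]))
  exact (sq_le_one_iff₀ (norm_nonneg _)).1 (h1.trans h2)

/-! #### A dense sequence of `L²(ℝ³; ℝ³)` and the directions `E n ⟂ W` -/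

/-- `L²(ℝ³; ℝ³)` has a dense sequence (it is second countable: Lebesgue measure is separable). [folklore] -/
theorem exists_denseSeq :
    ∃ d : ℕ → Lp ℝ³ 2 (volume : Measure ℝ³), DenseRange d := by
  haveI : Fact ((2 : ℝ≥0∞) ≠ ⊤) := ⟨ENNReal.ofNat_ne_top⟩
  exact TopologicalSpace.exists_dense_seq _

/-- A dense sequence in `L²(ℝ³; ℝ³)`. [folklore] -/
def dseq : ℕ → Lp ℝ³ 2 (volume : Measure ℝ³) := Classical.choose exists_denseSeq

/-- `dseq` has dense range. [folklore] -/
theorem denseRange_dseq : DenseRange dseq := Classical.choose_spec exists_denseSeq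

/-- Strongly measurable representatives of the dense sequence. [folklore] -/
def gseq (n : ℕ) : ℝ³ → ℝ³ := (Lp.aestronglyMeasurable (dseq n)).mk _

/-- The representatives are strongly measurable. [folklore] -/
theorem stronglyMeasurable_gseq (n : ℕ) : StronglyMeasurable (gseq n) :=
  (Lp.aestronglyMeasurable (dseq n)).stronglyMeasurable_mk

/-- The representatives represent. [folklore] -/
theorem gseq_ae_eq (n : ℕ) : gseq n =ᵐ[volume] dseq n :=
  (Lp.aestronglyMeasurable (dseq n)).ae_eq_mk.symm

/-- The representatives are square integrable. [folklore] -/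
theorem memLp_gseq (n : ℕ) : MemLp (gseq n) 2 (volume : Measure ℝ³) :=
  (Lp.memLp (dseq n)).ae_eq (gseq_ae_eq n).symm

/-- The coefficient of the `L²`-projection onto `span W`. [folklore] -/
def coefW (g : ℝ³ → ℝ³) : ℝ := (∫ x, ⟪g x, W x⟫) / m₀

/-- The `L²`-projection onto `W^⊥`: `g - (⟪g, W⟫/‖W‖²) W`. [folklore] -/
def perpW (g : ℝ³ → ℝ³) (x : ℝ³) : ℝ³ := g x - coefW g • W x

/-- The normalising factor `(1 + ‖perpW g‖₂)⁻¹`. [folklore] -/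
def nrm (g : ℝ³ → ℝ³) : ℝ := (1 + (eLpNorm (perpW g) 2 (volume : Measure ℝ³)).toReal)⁻¹

/-- The normalised projection, of `L²` norm `≤ 1`. [folklore] -/
def dirOf (g : ℝ³ → ℝ³) (x : ℝ³) : ℝ³ := nrm g • perpW g x

/-- The directions: `E 0 = 0` and `E (n+1)` the normalised projection of the `n`-th member of the
dense sequence. [folklore] -/
def Edir : ℕ → ℝ³ → ℝ³
  | 0 => 0
  | n + 1 => dirOf (gseq n)

/-- The normalising factor is positive. [folklore] -/
theorem nrm_pos (g : ℝ³ → ℝ³) : 0 < nrm g := by unfold nrm; positivity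

/-- The projection of an `L²` field is `L²`. [folklore] -/
theorem memLp_perpW {g : ℝ³ → ℝ³} (hg : MemLp g 2 (volume : Measure ℝ³)) :
    MemLp (perpW g) 2 (volume : Measure ℝ³) := by
  have h1 : MemLp (fun x => coefW g • W x) 2 (volume : Measure ℝ³) := memLp_W.const_smul (coefW g)
  exact hg.sub h1

/-- The normalised projection of an `L²` field is `L²`. [folklore] -/
theorem memLp_dirOf {g : ℝ³ → ℝ³} (hg : MemLp g 2 (volume : Measure ℝ³)) :
    MemLp (dirOf g) 2 (volume : Measure ℝ³) := by
  have h1 : MemLp (fun x => nrm g • perpW g x) 2 (volume : Measure ℝ³) :=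
    (memLp_perpW hg).const_smul (nrm g)
  exact h1

/-- The normalised projection of a strongly measurable field is strongly measurable. [folklore] -/
theorem stronglyMeasurable_dirOf {g : ℝ³ → ℝ³} (hg : StronglyMeasurable g) :
    StronglyMeasurable (dirOf g) := by
  have h1 : StronglyMeasurable (perpW g) :=
    hg.sub (continuous_W.stronglyMeasurable.const_smul (coefW g))
  exact h1.const_smul (nrm g)

/-- The directions are square integrable. [folklore] -/
theorem memLp_Edir (n : ℕ) : MemLp (Edir n) 2 (volume : Measure ℝ³) := by
  cases n with
  | zero => exact MemLp.zero
  | succ n => exact memLp_dirOf (memLp_gseq n)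

/-- The directions are strongly measurable. [folklore] -/
theorem stronglyMeasurable_Edir (n : ℕ) : StronglyMeasurable (Edir n) := by
  cases n with
  | zero => exact stronglyMeasurable_const
  | succ n => exact stronglyMeasurable_dirOf (stronglyMeasurable_gseq n)

/-- `‖dirOf g‖₂ ≤ 1`. [folklore] -/
theorem eLpNorm_dirOf_le_one {g : ℝ³ → ℝ³} (hg : MemLp g 2 (volume : Measure ℝ³)) :
    eLpNorm (dirOf g) 2 (volume : Measure ℝ³) ≤ 1 := by
  have hfin : eLpNorm (perpW g) 2 volume ≠ ⊤ := (memLp_perpW hg).eLpNorm_ne_top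
  set r : ℝ := (eLpNorm (perpW g) 2 (volume : Measure ℝ³)).toReal with hr
  have hr0 : 0 ≤ r := ENNReal.toReal_nonneg
  have hdef : dirOf g = nrm g • perpW g := rfl
  rw [hdef, eLpNorm_const_smul, Real.enorm_eq_ofReal (nrm_pos g).le, ← ENNReal.ofReal_toReal hfin,
    ← hr, ← ENNReal.ofReal_mul (nrm_pos g).le, ENNReal.ofReal_le_one]
  unfold nrm
  rw [← hr, inv_mul_le_iff₀ (by positivity)]
  linarith

/-- `‖E n‖₂ ≤ 1`. [folklore] -/
theorem eLpNorm_Edir_le_one (n : ℕ) : eLpNorm (Edir n) 2 (volume : Measure ℝ³) ≤ 1 := by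
  cases n with
  | zero => simp [Edir]
  | succ n => exact eLpNorm_dirOf_le_one (memLp_gseq n)

/-- `perpW g ⟂ W`. [folklore] -/
theorem integral_inner_perpW_W {g : ℝ³ → ℝ³} (hg : MemLp g 2 (volume : Measure ℝ³)) :
    ∫ x, ⟪perpW g x, W x⟫ = 0 := by
  have h1 : Integrable (fun x => ⟪g x, W x⟫) volume := integrable_inner_of_memLp_two hg memLp_W
  have h2 : Integrable (fun x => ⟪W x, W x⟫) volume :=
    integrable_inner_of_memLp_two memLp_W memLp_W
  simp only [perpW, inner_sub_left, real_inner_smul_left]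
  rw [integral_sub h1 (h2.const_mul _), integral_const_mul, integral_inner_W_W, coefW,
    div_mul_cancel₀ _ m₀_pos.ne', sub_self]

/-- `E n ⟂ W`. [folklore] -/
theorem integral_inner_Edir_W (n : ℕ) : ∫ x, ⟪Edir n x, W x⟫ = 0 := by
  cases n with
  | zero => simp [Edir]
  | succ n =>
    simp only [Edir, dirOf, real_inner_smul_left, integral_const_mul,
      integral_inner_perpW_W (memLp_gseq n), mul_zero]

/-- **Richness of the directions.** A continuous compactly supported field orthogonal to every
`E (n+1)` vanishes identically: it is then `L²`-orthogonal to a dense set after subtracting its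
component along `W`, hence a multiple of `W` a.e.; but `W` does not vanish a.e. outside any ball
while the field does. [folklore] -/
theorem eq_zero_of_forall_integral_inner_Edir {φ : ℝ³ → ℝ³} (hφc : Continuous φ)
    (hφs : HasCompactSupport φ) (h : ∀ n, ∫ x, ⟪Edir (n + 1) x, φ x⟫ = 0) : φ = 0 := by
  have hφ2 : MemLp φ 2 (volume : Measure ℝ³) := hφc.memLp_of_hasCompactSupport hφs
  set κ : ℝ := (∫ x, ⟪W x, φ x⟫) / m₀ with hκ
  -- Step 1: `∫ ⟪gseq n, φ - κ W⟫ = 0`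
  have h1 : ∀ n, ∫ x, ⟪gseq n x, φ x - κ • W x⟫ = 0 := by
    intro n
    have hg := memLp_gseq n
    have hi1 : Integrable (fun x => ⟪gseq n x, φ x⟫) volume := integrable_inner_of_memLp_two hg hφ2
    have hi2 : Integrable (fun x => ⟪W x, φ x⟫) volume := integrable_inner_of_memLp_two memLp_W hφ2
    have hi3 : Integrable (fun x => ⟪gseq n x, W x⟫) volume :=
      integrable_inner_of_memLp_two hg memLp_W
    have h0 : nrm (gseq n) * ((∫ x, ⟪gseq n x, φ x⟫) -
        coefW (gseq n) * ∫ x, ⟪W x, φ x⟫) = 0 := by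
      rw [← h n]
      simp only [Edir, dirOf, perpW, real_inner_smul_left, inner_sub_left, integral_const_mul]
      rw [integral_sub hi1 (hi2.const_mul _), integral_const_mul]
    have h0' : (∫ x, ⟪gseq n x, φ x⟫) - coefW (gseq n) * ∫ x, ⟪W x, φ x⟫ = 0 :=
      (mul_eq_zero.1 h0).resolve_left (nrm_pos _).ne'
    simp only [inner_sub_right, real_inner_smul_right]
    rw [integral_sub hi1 (hi3.const_mul _), integral_const_mul]
    have heq : κ * ∫ x, ⟪gseq n x, W x⟫ = coefW (gseq n) * ∫ x, ⟪W x, φ x⟫ := by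
      rw [hκ, coefW]
      field_simp
    rw [heq]
    exact h0'
  -- Step 2: `φ - κ W = 0` a.e.
  have hmem : MemLp (fun x => φ x - κ • W x) 2 (volume : Measure ℝ³) :=
    hφ2.sub (memLp_W.const_smul κ)
  set Φ : Lp ℝ³ 2 (volume : Measure ℝ³) := hmem.toLp _ with hΦ
  have horth : ∀ n, ⟪dseq n, Φ⟫ = 0 := by
    intro n
    rw [L2.inner_def, ← h1 n]
    refine integral_congr_ae ?_
    filter_upwards [gseq_ae_eq n, hmem.coeFn_toLp] with x hx hΦx
    rw [hΦx, ← hx]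
  have hΦ0 : Φ = 0 := by
    have hclosed : IsClosed {f : Lp ℝ³ 2 (volume : Measure ℝ³) | ⟪f, Φ⟫ = 0} :=
      isClosed_eq (continuous_id.inner continuous_const) continuous_const
    have hsub : Set.range dseq ⊆ {f | ⟪f, Φ⟫ = 0} := by
      rintro _ ⟨n, rfl⟩; exact horth n
    have hall : closure (Set.range dseq) ⊆ {f | ⟪f, Φ⟫ = 0} := hclosed.closure_subset_iff.2 hsub
    rw [denseRange_dseq.closure_eq] at hall
    have hself : ⟪Φ, Φ⟫ = 0 := hall (Set.mem_univ Φ)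
    exact inner_self_eq_zero.1 hself
  have hae : (fun x => φ x - κ • W x) =ᵐ[volume] (0 : ℝ³ → ℝ³) := by
    have h2 : ((Φ : Lp ℝ³ 2 (volume : Measure ℝ³)) : ℝ³ → ℝ³) =ᵐ[volume] (0 : ℝ³ → ℝ³) := by
      rw [hΦ0]; exact Lp.coeFn_zero _ _ _
    exact hmem.coeFn_toLp.symm.trans h2
  -- Step 3: `κ = 0`, whence `φ = 0`
  by_cases hκ0 : κ = 0
  · have h3 : φ =ᵐ[volume] (fun _ => (0 : ℝ³)) := by
      filter_upwards [hae] with x hx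
      simpa [hκ0, sub_eq_zero] using hx
    exact (Continuous.ae_eq_iff_eq volume hφc continuous_const).1 h3
  · exfalso
    obtain ⟨R, hR⟩ := hφs.isCompact.isBounded.subset_closedBall (0 : ℝ³)
    refine not_ae_W_eq_zero_far R ?_
    filter_upwards [hae] with x hx hxR
    have hφx : φ x = 0 := by
      refine image_eq_zero_of_notMem_tsupport fun hm => ?_
      have := hR hm
      rw [mem_closedBall, dist_zero_right] at this
      linarith
    have hsm : κ • W x = 0 := by
      have hx' : φ x - κ • W x = 0 := hx
      rwa [hφx, zero_sub, neg_eq_zero] at hx'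
    exact (smul_eq_zero.1 hsm).resolve_left hκ0

/-! #### The class map, the force and the velocities -/

/-- The class map `k : ℝ → ℕ` of `Literature/MeasureTheory/Lebesgue/ThickPartition.lean`
(`ThickPartition.exists_classMap_restrict_eq_volume`): every fibre has full outer Lebesgue
measure. [folklore] -/
def kcl : ℝ → ℕ :=
  Classical.choose Literature.MeasureTheory.Lebesgue.ThickPartition.exists_classMap_restrict_eq_volume

/-- Every fibre of `kcl` has full outer measure (is thick). [folklore] -/
theorem restrict_kcl_fibre (n : ℕ) : (volume : Measure ℝ).restrict (kcl ⁻¹' {n}) = volume :=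
  Classical.choose_spec
    Literature.MeasureTheory.Lebesgue.ThickPartition.exists_classMap_restrict_eq_volume n

/-- The honest amplitude `p(t) = 1 + ν t m₁/m₀` of the force along `W`. [folklore] -/
def pf (ν t : ℝ) : ℝ := 1 + ν * m₁ / m₀ * t

/-- The amplitude is continuous in time. [folklore] -/
theorem continuous_pf (ν : ℝ) : Continuous (pf ν) :=
  continuous_const.add (continuous_const.mul continuous_id)

/-- **The force** `f(t) = p(t) W + E_{k(t)}`: an honest part along `W` and a part which is not
measurable in time (its direction is chosen by the class of `t`). [folklore] -/
def force (ν : ℝ) (t : ℝ) (x : ℝ³) : ℝ³ := pf ν t • W x + Edir (kcl t) x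

/-- The second solution `v(t) = t W`. [folklore] -/
def vel (t : ℝ) (x : ℝ³) : ℝ³ := t • W x

/-- Every slice of the force is in `L²`. [folklore] -/
theorem memLp_force (ν t : ℝ) : MemLp (force ν t) 2 (volume : Measure ℝ³) := by
  have h1 : MemLp (fun x => pf ν t • W x) 2 (volume : Measure ℝ³) := memLp_W.const_smul (pf ν t)
  have h2 : MemLp (fun x => Edir (kcl t) x) 2 (volume : Measure ℝ³) := memLp_Edir _
  exact h1.add h2

/-- `v` is jointly continuous. [folklore] -/
theorem continuous_vel : Continuous (uncurry vel) :=
  continuous_fst.smul (continuous_W.comp continuous_snd)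

/-- `v(0) = 0`. [folklore] -/
theorem vel_zero : vel 0 = 0 := by
  funext x; simp [vel]

/-- Every slice of `v` is `C¹`. [folklore] -/
theorem contDiff_vel (t : ℝ) : ContDiff ℝ 1 (vel t) :=
  (contDiff_W (n := 1)).const_smul t

/-- `∇v(t) = t ∇W`. [folklore] -/
theorem fderiv_vel (t : ℝ) (x : ℝ³) : fderiv ℝ (vel t) x = t • fderiv ℝ W x :=
  fderiv_fun_const_smul ((contDiff_W (n := 1)).differentiable one_ne_zero x) t

/-! #### The weak identity: the dichotomy -/

/-- Slices of a continuous compactly supported function on `ℝ × ℝ³` are integrable. [folklore] -/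
theorem integrable_slice {G : ℝ × ℝ³ → ℝ} (hG : Continuous G) (hGs : HasCompactSupport G) (t : ℝ) :
    Integrable (fun x => G (t, x)) (volume : Measure ℝ³) := by
  refine (hG.comp (continuous_const.prodMk continuous_id)).integrable_of_hasCompactSupport ?_
  refine HasCompactSupport.intro (hGs.image continuous_snd) fun x hx => ?_
  exact image_eq_zero_of_notMem_tsupport (f := G) fun h => hx ⟨(t, x), h, rfl⟩

/-- **The weak identity with force `f` and datum `0` holds for every velocity field `w` which is
merely jointly continuous** — in particular for `w = 0` and `w = v`. For a divergence-free test
field `ψ` let `e_n(t) = ∫ ⟪E_n, ψ(t)⟫`. The `f`-part of the slice integrand splits off the wild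
term `e_{k(t)}(t)`, the rest being a measurable function of `t`. Either `t ↦ e_{k(t)}(t)` is not
a.e.-strongly measurable on `(0, 1)` — then neither is the slice integrand, and its Bochner
integral in time is `0` by Mathlib's convention (`integral_non_aestronglyMeasurable`); or it is,
and then, all fibres of `k` having full outer measure, `e_n = e_0 = 0` a.e. for every `n`
(`ThickPartition.ae_eq_of_aestronglyMeasurable_lift`), so by the richness of the directions
`ψ(t) = 0` for a.e., hence (openness) every, `t ∈ (0, 1)`: the integrand vanishes identically on
`(0, 1)`. The datum term is `∫ ⟪0, ψ(0)⟫ = 0`. [folklore] -/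
theorem weak_identity (ν : ℝ) {w : ℝ → ℝ³ → ℝ³} (hw : Continuous (uncurry w))
    {ψ : ℝ → ℝ³ → ℝ³} (hψ : IsSpaceTimeTestOn (slab ℝ³ (Iio 1) isOpen_Iio) ψ) :
    (∫ t in Ioo (0 : ℝ) 1, ∫ x, (⟪w t x, timeDeriv ψ t x⟫ + ⟪w t x, convect (w t) (ψ t) x⟫ +
        ν * ⟪w t x, Δ (ψ t) x⟫ + ⟪force ν t x, ψ t x⟫)) + ∫ x, ⟪(0 : ℝ³ → ℝ³) x, ψ 0 x⟫ = 0 := by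
  have hψ' : IsSpaceTimeTestOn (⊤ : Opens (ℝ × ℝ³)) ψ := hψ.mono le_top
  have hψc : Continuous (uncurry ψ) := hψ.contDiff.continuous
  have hdatum : ∫ x, ⟪(0 : ℝ³ → ℝ³) x, ψ 0 x⟫ = 0 := by simp
  rw [hdatum, add_zero]
  -- the tame part `A` of the slice integrand, and the functions `e n`
  set A : ℝ × ℝ³ → ℝ := fun z => ⟪w z.1 z.2, timeDeriv ψ z.1 z.2⟫ +
      ⟪w z.1 z.2, fderiv ℝ (ψ z.1) z.2 (w z.1 z.2)⟫ + ν * ⟪w z.1 z.2, Δ (ψ z.1) z.2⟫ +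
      ⟪pf ν z.1 • W z.2, ψ z.1 z.2⟫ with hA
  set e : ℕ → ℝ → ℝ := fun n t => ∫ x, ⟪Edir n x, ψ t x⟫ with he
  have hw' : Continuous fun z : ℝ × ℝ³ => w z.1 z.2 := hw
  have hAc : Continuous A := by
    refine (((hw'.inner hψ.continuous_timeDeriv).add
      (hw'.inner (hψ.continuous_fderiv_slice.clm_apply hw'))).add
      (continuous_const.mul (hw'.inner hψ.continuous_laplacian_slice))).add ?_
    exact (((continuous_pf ν).comp continuous_fst).smul (continuous_W.comp continuous_snd)).inner
      hψc
  have hAs : HasCompactSupport A := by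
    refine ((HasCompactSupport.add ?_ ?_).add ?_).add ?_
    · exact hψ'.timeDeriv_top.hasCompactSupport.mono fun z hz => by
        contrapose! hz
        have hz' : timeDeriv ψ z.1 z.2 = 0 := notMem_support.1 hz
        simp only [notMem_support]
        rw [hz', inner_zero_right]
    · exact hψ'.fderiv_top.hasCompactSupport.mono fun z hz => by
        contrapose! hz
        have hz' : fderiv ℝ (ψ z.1) z.2 = 0 := notMem_support.1 hz
        simp only [notMem_support]
        rw [hz']
        simp
    · exact hψ'.laplacian_top.hasCompactSupport.mono fun z hz => by
        contrapose! hz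
        have hz' : Δ (ψ z.1) z.2 = 0 := notMem_support.1 hz
        simp only [notMem_support]
        rw [hz', inner_zero_right, mul_zero]
    · exact hψ.hasCompactSupport.mono fun z hz => by
        contrapose! hz
        have hz' : ψ z.1 z.2 = 0 := notMem_support.1 hz
        simp only [notMem_support]
        rw [hz', inner_zero_right]
  have hAi : ∀ t, Integrable (fun x => A (t, x)) (volume : Measure ℝ³) := fun t =>
    integrable_slice hAc hAs t
  have hBi : ∀ t, Integrable (fun x => ⟪Edir (kcl t) x, ψ t x⟫) (volume : Measure ℝ³) := fun t =>
    integrable_inner_of_memLp_two (memLp_Edir _) (hψ.memLp_slice t 2)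
  -- splitting the slice integrand
  have hsplit : ∀ t, (∫ x, (⟪w t x, timeDeriv ψ t x⟫ + ⟪w t x, convect (w t) (ψ t) x⟫ +
      ν * ⟪w t x, Δ (ψ t) x⟫ + ⟪force ν t x, ψ t x⟫)) = (∫ x, A (t, x)) + e (kcl t) t := by
    intro t
    rw [← integral_add (hAi t) (hBi t)]
    refine integral_congr_ae (Eventually.of_forall fun x => ?_)
    simp only [hA, force, inner_add_left, convect_apply]
    ring
  rw [setIntegral_congr_fun measurableSet_Ioo (fun t _ => hsplit t)]
  -- measurability of the tame part and of the `e n`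
  have hΦm : AEStronglyMeasurable (fun t => ∫ x, A (t, x))
      ((volume : Measure ℝ).restrict (Ioo (0 : ℝ) 1)) :=
    (hAc.stronglyMeasurable.integral_prod_right' (ν := (volume : Measure ℝ³))).aestronglyMeasurable
  have hem : ∀ n, Measurable (e n) := fun n => by
    have hc : StronglyMeasurable (fun z : ℝ × ℝ³ => ⟪Edir n z.2, ψ z.1 z.2⟫) :=
      ((stronglyMeasurable_Edir n).comp_measurable measurable_snd).inner hψc.stronglyMeasurable
    exact (hc.integral_prod_right' (ν := (volume : Measure ℝ³))).measurable
  by_cases hmeas : AEStronglyMeasurable (fun t => e (kcl t) t)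
      ((volume : Measure ℝ).restrict (Ioo (0 : ℝ) 1))
  · -- the tame case: all slices of `ψ` vanish on `(0, 1)`
    have hae : ∀ n, e (n + 1) =ᵐ[(volume : Measure ℝ).restrict (Ioo (0 : ℝ) 1)] e 0 := fun n =>
      Literature.MeasureTheory.Lebesgue.ThickPartition.ae_eq_of_aestronglyMeasurable_lift
        restrict_kcl_fibre hem measurableSet_Ioo hmeas (n + 1) 0
    have he0 : ∀ t, e 0 t = 0 := fun t => by simp [he, Edir]
    have hall : ∀ᵐ t ∂((volume : Measure ℝ).restrict (Ioo (0 : ℝ) 1)), ∀ n, e (n + 1) t = 0 := by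
      rw [ae_all_iff]
      intro n
      filter_upwards [hae n] with t ht
      rw [ht, he0]
    have hzero_ae : ∀ᵐ t ∂((volume : Measure ℝ).restrict (Ioo (0 : ℝ) 1)), ψ t = 0 := by
      filter_upwards [hall] with t ht
      exact eq_zero_of_forall_integral_inner_Edir (hψ.contDiff_slice t).continuous
        (hψ.hasCompactSupport_slice t) fun n => ht n
    have hzero : ∀ t ∈ Ioo (0 : ℝ) 1, ψ t = 0 := by
      set V : Set ℝ := {t | ψ t ≠ 0} with hV
      have hVo : IsOpen V := by
        have hVeq : V = ⋃ x : ℝ³, {t | ψ t x ≠ 0} := by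
          ext t
          simp only [hV, mem_setOf_eq, mem_iUnion, ne_eq, funext_iff, Pi.zero_apply, not_forall]
        rw [hVeq]
        exact isOpen_iUnion fun x =>
          isOpen_ne_fun (hψc.comp (continuous_id.prodMk continuous_const)) continuous_const
      have hV0 : volume (V ∩ Ioo (0 : ℝ) 1) = 0 := by
        have h0 := hzero_ae
        rw [ae_iff, Measure.restrict_apply' measurableSet_Ioo] at h0
        exact h0
      intro t ht
      by_contra hne
      have hpos := (hVo.inter isOpen_Ioo).measure_pos (volume : Measure ℝ) ⟨t, hne, ht⟩
      exact hpos.ne' hV0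
    have hAt : ∀ t ∈ Ioo (0 : ℝ) 1, (∫ x, A (t, x)) + e (kcl t) t = 0 := by
      intro t ht
      have hψt : ψ t = fun _ => (0 : ℝ³) := hzero t ht
      have htd : ∀ x, deriv (fun s => ψ s x) t = 0 := fun x => by
        have hev : (fun s => ψ s x) =ᶠ[𝓝 t] fun _ => (0 : ℝ³) := by
          filter_upwards [Ioo_mem_nhds ht.1 ht.2] with s hs
          rw [hzero s hs]
          rfl
        rw [hev.deriv_eq, deriv_const]
      have h1 : (∫ x, A (t, x)) = 0 := by
        simp [hA, htd, hψt]
      have h2 : e (kcl t) t = 0 := by simp [he, hψt]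
      rw [h1, h2, add_zero]
    rw [setIntegral_congr_fun measurableSet_Ioo hAt]
    simp
  · -- the wild case: the slice integrand is not a.e.-strongly measurable in time
    refine integral_non_aestronglyMeasurable fun hsum => hmeas ?_
    exact (hsum.sub hΦm).congr (Eventually.of_forall fun t => by simp)

/-! #### The energy balance of `v(t) = t W` -/

/-- `E(v(t)) = ½ t² m₀`. [folklore] -/
theorem kineticEnergy_vel (t : ℝ) :
    VectorCalculus.kineticEnergy (vel t) = 2⁻¹ * (t ^ 2 * m₀) := by
  unfold VectorCalculus.kineticEnergy m₀
  congr 1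
  simp only [vel, norm_smul, mul_pow, Real.norm_eq_abs, sq_abs]
  exact integral_const_mul _ _

/-- The honest forcing power: `∫ ⟪f(τ), v(τ)⟫ = τ p(τ) m₀` (the wild part is `⟂ W`). [folklore] -/
theorem integral_inner_force_vel (ν τ : ℝ) :
    ∫ x, ⟪force ν τ x, vel τ x⟫ = τ * pf ν τ * m₀ := by
  have h1 : Integrable (fun x => ⟪W x, W x⟫) (volume : Measure ℝ³) :=
    integrable_inner_of_memLp_two memLp_W memLp_W
  have h2 : Integrable (fun x => ⟪Edir (kcl τ) x, W x⟫) (volume : Measure ℝ³) :=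
    integrable_inner_of_memLp_two (memLp_Edir _) memLp_W
  have hpt : ∀ x, ⟪force ν τ x, vel τ x⟫ = τ * pf ν τ * ⟪W x, W x⟫ + τ * ⟪Edir (kcl τ) x, W x⟫ := by
    intro x
    simp only [force, vel, inner_add_left, real_inner_smul_left, real_inner_smul_right]
    ring
  simp_rw [hpt]
  rw [integral_add ((h1.const_mul _)) (h2.const_mul _), integral_const_mul, integral_const_mul,
    integral_inner_W_W, integral_inner_Edir_W, mul_zero, add_zero]

/-- The dissipation of `v` on a slice: `∫⁻ |∇v(τ)|² = τ² m₁`. [folklore] -/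
theorem lintegral_frobenius_vel (τ : ℝ) :
    ∫⁻ x, ENNReal.ofReal (frobeniusNormSq (fderiv ℝ (vel τ) x)) ∂(volume : Measure ℝ³) =
      ENNReal.ofReal (τ ^ 2 * m₁) := by
  simp_rw [fderiv_vel, frobeniusNormSq_smul]
  rw [← ofReal_integral_eq_lintegral_ofReal (integrable_frobeniusNormSq_fderiv_W.const_mul _)
    (Eventually.of_forall fun x => mul_nonneg (sq_nonneg _) (frobeniusNormSq_nonneg _)),
    integral_const_mul]
  rfl

/-- The dissipation of `v` on `(s, t)`: `∫ₛᵗ ∫ |∇v|² = m₁ (t³ - s³)/3` (as a lower integral). [folklore] -/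
theorem setLIntegral_frobenius_vel {s t : ℝ} (hst : s ≤ t) :
    ∫⁻ τ in Ioo s t, ∫⁻ x, ENNReal.ofReal (frobeniusNormSq (fderiv ℝ (vel τ) x))
      ∂(volume : Measure ℝ³) = ENNReal.ofReal (m₁ * (t ^ 3 - s ^ 3) / 3) := by
  simp_rw [lintegral_frobenius_vel]
  have hint : IntegrableOn (fun τ : ℝ => τ ^ 2 * m₁) (Ioo s t) volume :=
    (Continuous.integrableOn_Icc (by fun_prop)).mono_set Ioo_subset_Icc_self
  rw [← ofReal_integral_eq_lintegral_ofReal hint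
    (Eventually.of_forall fun τ => mul_nonneg (sq_nonneg _) m₁_nonneg)]
  congr 1
  rw [← integral_Ioc_eq_integral_Ioo, ← intervalIntegral.integral_of_le hst,
    intervalIntegral.integral_mul_const, integral_pow]
  ring

/-- The forcing work on `(s, t)`: `∫ₛᵗ ∫ ⟪f, v⟫ = m₀(t² - s²)/2 + ν m₁ (t³ - s³)/3`. [folklore] -/
theorem integral_forcing_vel (ν s t : ℝ) :
    ∫ τ in s..t, ∫ x, ⟪force ν τ x, vel τ x⟫ =
      m₀ * (t ^ 2 - s ^ 2) / 2 + ν * m₁ * (t ^ 3 - s ^ 3) / 3 := by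
  simp_rw [integral_inner_force_vel]
  have heq : (fun τ => τ * pf ν τ * m₀) = fun τ => m₀ * τ + ν * m₁ * τ ^ 2 := by
    funext τ
    unfold pf
    have hm : m₀ ≠ 0 := m₀_pos.ne'
    field_simp
  rw [heq, intervalIntegral.integral_add, intervalIntegral.integral_const_mul,
    intervalIntegral.integral_const_mul, integral_id, integral_pow]
  · ring
  · exact (continuous_const.mul continuous_id).intervalIntegrable _ _
  · exact (continuous_const.mul (continuous_pow 2)).intervalIntegrable _ _

/-- **The energy (in)equality of `v`** from any `s ≤ t` (an identity, by the choice of `p`). [folklore] -/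
theorem energy_ineq_vel (ν : ℝ) {s t : ℝ} (hs : 0 ≤ s) (hst : s ≤ t) :
    VectorCalculus.kineticEnergy (vel t) +
      ν * (∫⁻ τ in Ioo s t, ∫⁻ x, ENNReal.ofReal (frobeniusNormSq (fderiv ℝ (vel τ) x))
        ∂(volume : Measure ℝ³)).toReal ≤
      VectorCalculus.kineticEnergy (vel s) + ∫ τ in s..t, ∫ x, ⟪force ν τ x, vel τ x⟫ := by
  rw [kineticEnergy_vel, kineticEnergy_vel, setLIntegral_frobenius_vel hst, integral_forcing_vel,
    ENNReal.toReal_ofReal]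
  · apply le_of_eq; ring
  · have h3 : s ^ 3 ≤ t ^ 3 := pow_le_pow_left₀ hs hst 3
    exact div_nonneg (mul_nonneg m₁_nonneg (sub_nonneg.2 h3)) (by norm_num)


/-! #### The two Leray–Hopf solutions -/

/-- **`v(t) = t W` is a Leray–Hopf solution on `[0, 1)` with force `f` and datum `0`.** The weak
identity is `weak_identity`; everything else is honest: `v ∈ C([0,1]; L²) ∩ L²H¹` with weak
gradient `t ∇W`, the energy inequalities are the identity `energy_ineq_vel`, and `v(t) → 0` in `L²`
as `t → 0⁺`. [folklore] -/
theorem isLerayHopfOn_vel (ν : ℝ) : IsLerayHopfOn 1 ν (force ν) 0 vel where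
  weak := by
    refine ⟨continuous_vel.aestronglyMeasurable, fun K hK => ?_, ?_, fun ψ hψ _ =>
      weak_identity ν continuous_vel hψ⟩
    · have hS : MeasurableSet (Ioo (0 : ℝ) 1 ×ˢ K) := measurableSet_Ioo.prod hK.measurableSet
      have hle : ∀ z ∈ Ioo (0 : ℝ) 1 ×ˢ K, ‖uncurry vel z‖ₑ ^ 2 ≤ 1 := by
        rintro ⟨t, x⟩ ⟨ht, -⟩
        have h1 : ‖vel t x‖ ≤ 1 := by
          rw [vel, norm_smul, Real.norm_eq_abs, abs_of_pos ht.1]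
          calc t * ‖W x‖ ≤ 1 * 1 := by
                gcongr
                · exact ht.2.le
                · exact norm_W_le_one x
            _ = 1 := one_mul 1
        have h2 : ‖vel t x‖ₑ ≤ 1 := by
          rw [← ofReal_norm]
          exact ENNReal.ofReal_le_one.2 h1
        calc ‖uncurry vel (t, x)‖ₑ ^ 2 = ‖vel t x‖ₑ ^ 2 := rfl
          _ ≤ 1 ^ 2 := by gcongr
          _ = 1 := one_pow 2
      calc ∫⁻ z in Ioo (0 : ℝ) 1 ×ˢ K, ‖uncurry vel z‖ₑ ^ 2
          ≤ ∫⁻ _ in Ioo (0 : ℝ) 1 ×ˢ K, 1 := setLIntegral_mono' hS hle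
        _ = volume (Ioo (0 : ℝ) 1 ×ˢ K) := by rw [setLIntegral_const, one_mul]
        _ < ⊤ := volume_Ioo_prod_lt_top hK
    · exact ae_of_all _ fun t => isWeaklyDivFree_W.const_smul t
  energy_bound := by
    refine ⟨(eEnergy W).toNNReal, (ae_restrict_iff' measurableSet_Ioo).2 (ae_of_all _ fun t ht => ?_)⟩
    have hfin : eEnergy W ≠ ⊤ := by
      rw [eEnergy_eq_ofReal W memLp_W]; exact ENNReal.ofReal_ne_top
    rw [ENNReal.coe_toNNReal hfin]
    refine lintegral_mono fun x => ?_
    have ht1 : ‖t‖ₑ ≤ 1 := by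
      rw [Real.enorm_eq_ofReal_abs, abs_of_pos ht.1]
      exact ENNReal.ofReal_le_one.2 ht.2.le
    calc ‖vel t x‖ₑ ^ 2 = (‖t‖ₑ * ‖W x‖ₑ) ^ 2 := by rw [vel, enorm_smul]
      _ ≤ (1 * ‖W x‖ₑ) ^ 2 := by gcongr
      _ = ‖W x‖ₑ ^ 2 := by rw [one_mul]
  memLp := fun t _ => memLp_W.const_smul t
  weakGrad_energy := by
    refine ⟨fun t => fderiv ℝ (vel t), ae_of_all _ fun t =>
      hasWeakGradient_fderiv_of_contDiff (contDiff_vel t), ?_, fun t ht => ?_, ?_⟩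
    · rw [setLIntegral_frobenius_vel zero_le_one]
      exact ENNReal.ofReal_lt_top
    · have h := energy_ineq_vel ν le_rfl ht.1
      rw [vel_zero] at h
      exact h
    · exact (ae_restrict_iff' measurableSet_Ioo).2 (ae_of_all _ fun s hs t ht =>
        energy_ineq_vel ν hs.1.le ht.1)
  weak_continuous := by
    intro w hw
    have heq : (fun t => ∫ x, ⟪vel t x, w x⟫) = fun t => t * ∫ x, ⟪W x, w x⟫ := by
      funext t
      simp only [vel, real_inner_smul_left, integral_const_mul]
    rw [heq]
    refine ⟨(continuous_id.mul continuous_const).continuousOn, ?_⟩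
    have h0 : Tendsto (fun t : ℝ => t * ∫ x, ⟪W x, w x⟫) (𝓝 0) (𝓝 (0 * ∫ x, ⟪W x, w x⟫)) :=
      (continuous_id.mul continuous_const).tendsto 0
    rw [zero_mul] at h0
    simpa using h0.mono_left nhdsWithin_le_nhds
  strong_initial := by
    have heq : (fun t => eLpNorm (vel t - 0) 2 (volume : Measure ℝ³)) =
        fun t => ENNReal.ofReal |t| * eLpNorm W 2 (volume : Measure ℝ³) := by
      funext t
      rw [sub_zero, show vel t = t • W from rfl, eLpNorm_const_smul, Real.enorm_eq_ofReal_abs]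
    rw [heq]
    have h1 : Tendsto (fun t : ℝ => ENNReal.ofReal |t|) (𝓝 0) (𝓝 0) := by
      have := ENNReal.tendsto_ofReal ((continuous_abs.tendsto (0 : ℝ)))
      simpa using this
    have h2 := ENNReal.Tendsto.mul_const h1 (Or.inr memLp_W.eLpNorm_ne_top)
    rw [zero_mul] at h2
    exact h2.mono_left nhdsWithin_le_nhds

/-- **`u ≡ 0` is a Leray–Hopf solution on `[0, 1)` with the same force `f` and datum `0`**: the
weak identity is `weak_identity` (with `w = 0`), and all other clauses are trivial. [folklore] -/
theorem isLerayHopfOn_zero (ν : ℝ) : IsLerayHopfOn 1 ν (force ν) 0 (0 : ℝ → ℝ³ → ℝ³) where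
  weak := by
    have hc : Continuous (uncurry (0 : ℝ → ℝ³ → ℝ³)) := continuous_const
    have h0 : uncurry (0 : ℝ → ℝ³ → ℝ³) = fun _ => 0 := rfl
    refine ⟨hc.aestronglyMeasurable, fun K _ => by rw [h0]; simp, ae_of_all _ fun t => ?_,
      fun ψ hψ _ => weak_identity ν hc hψ⟩
    intro θ _
    simp
  energy_bound := ⟨0, ae_of_all _ fun t => by simp [eEnergy]⟩
  memLp := fun t _ => (MemLp.zero : MemLp (0 : ℝ³ → ℝ³) 2 (volume : Measure ℝ³))
  weakGrad_energy := by
    refine ⟨fun _ _ => 0, ae_of_all _ fun t => ?_, by simp, fun t _ => ?_, ae_of_all _ fun s t _ => ?_⟩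
    · have h := hasWeakGradient_fderiv_of_contDiff
        (contDiff_const : ContDiff ℝ 1 (fun _ : ℝ³ => (0 : ℝ³)))
      simp only [fderiv_fun_const] at h
      exact h
    · simp [VectorCalculus.kineticEnergy]
    · simp [VectorCalculus.kineticEnergy]
  weak_continuous := fun w _ => ⟨by simpa using continuousOn_const, by simp⟩
  strong_initial := by simp

/-! #### The force is in `L¹(0, 1; L²)` in the tree's (unguarded-in-time) sense -/

/-- `f ∈ L¹(0,1; L²)` in the sense of `MemLqLp 1 2 f (Ioo 0 1)`: every slice is in `L²` with
`‖f(t)‖₂ ≤ (1 + |ν| m₁/m₀) ‖W‖₂ + 1`, and `MemLqLp` asks nothing about the measurability of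
`t ↦ f(t)`. [folklore] -/
theorem memLqLp_force (ν : ℝ) : MemLqLp 1 2 (force ν) (Ioo 0 1) := by
  refine ⟨ae_of_all _ fun t => memLp_force ν t, ?_⟩
  set Cw : ℝ := (eLpNorm W 2 (volume : Measure ℝ³)).toReal with hCw
  set C : ℝ := (1 + |ν| * m₁ / m₀) * Cw + 1 with hC
  have hWfin : eLpNorm W 2 (volume : Measure ℝ³) ≠ ⊤ := memLp_W.eLpNorm_ne_top
  have hb : ∀ t ∈ Ioo (0 : ℝ) 1, ‖(eLpNorm (force ν t) 2 (volume : Measure ℝ³)).toReal‖ ≤ C := by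
    intro t ht
    rw [Real.norm_of_nonneg ENNReal.toReal_nonneg]
    have hE1 : eLpNorm (Edir (kcl t)) 2 (volume : Measure ℝ³) ≤ 1 := eLpNorm_Edir_le_one _
    have hEfin : eLpNorm (Edir (kcl t)) 2 (volume : Measure ℝ³) ≠ ⊤ :=
      ne_top_of_le_ne_top ENNReal.one_ne_top hE1
    have h1 : eLpNorm (force ν t) 2 (volume : Measure ℝ³) ≤
        ENNReal.ofReal |pf ν t| * eLpNorm W 2 volume + eLpNorm (Edir (kcl t)) 2 volume := by
      have hdef : force ν t = (pf ν t • W) + Edir (kcl t) := rfl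
      rw [hdef]
      refine (eLpNorm_add_le (memLp_W.const_smul _).1 (memLp_Edir _).1 one_le_two).trans ?_
      rw [eLpNorm_const_smul, Real.enorm_eq_ofReal_abs]
    have h2 : (eLpNorm (force ν t) 2 (volume : Measure ℝ³)).toReal ≤ |pf ν t| * Cw + 1 := by
      have hfin2 : ENNReal.ofReal |pf ν t| * eLpNorm W 2 volume +
          eLpNorm (Edir (kcl t)) 2 volume ≠ ⊤ :=
        ENNReal.add_ne_top.2 ⟨ENNReal.mul_ne_top ENNReal.ofReal_ne_top hWfin, hEfin⟩
      calc (eLpNorm (force ν t) 2 (volume : Measure ℝ³)).toReal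
          ≤ (ENNReal.ofReal |pf ν t| * eLpNorm W 2 volume +
              eLpNorm (Edir (kcl t)) 2 volume).toReal := ENNReal.toReal_mono hfin2 h1
        _ = |pf ν t| * Cw + (eLpNorm (Edir (kcl t)) 2 volume).toReal := by
            rw [ENNReal.toReal_add (ENNReal.mul_ne_top ENNReal.ofReal_ne_top hWfin) hEfin,
              ENNReal.toReal_mul, ENNReal.toReal_ofReal (abs_nonneg _)]
        _ ≤ |pf ν t| * Cw + 1 := by
            gcongr
            have := ENNReal.toReal_mono ENNReal.one_ne_top hE1
            simpa using this
    have h3 : |pf ν t| ≤ 1 + |ν| * m₁ / m₀ := by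
      unfold pf
      have hq0 : 0 ≤ m₁ / m₀ := div_nonneg m₁_nonneg m₀_pos.le
      have hq : 0 ≤ m₁ / m₀ * t := mul_nonneg hq0 ht.1.le
      have hq1 : m₁ / m₀ * t ≤ m₁ / m₀ := mul_le_of_le_one_right hq0 ht.2.le
      calc |1 + ν * m₁ / m₀ * t| = |1 + ν * (m₁ / m₀ * t)| := by congr 1; ring
        _ ≤ |(1 : ℝ)| + |ν * (m₁ / m₀ * t)| := abs_add_le _ _
        _ = 1 + |ν| * (m₁ / m₀ * t) := by rw [abs_one, abs_mul, abs_of_nonneg hq]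
        _ ≤ 1 + |ν| * (m₁ / m₀) := by gcongr
        _ = 1 + |ν| * m₁ / m₀ := by ring
    have hCw0 : 0 ≤ Cw := ENNReal.toReal_nonneg
    calc (eLpNorm (force ν t) 2 (volume : Measure ℝ³)).toReal ≤ |pf ν t| * Cw + 1 := h2
      _ ≤ (1 + |ν| * m₁ / m₀) * Cw + 1 := by gcongr
  unfold eLqLpNorm
  calc eLpNorm (fun t => (eLpNorm (force ν t) 2 (volume : Measure ℝ³)).toReal) 1
        ((volume : Measure ℝ).restrict (Ioo 0 1))
      ≤ ((volume : Measure ℝ).restrict (Ioo 0 1)) univ ^ (1 : ℝ≥0∞).toReal⁻¹ * ENNReal.ofReal C :=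
        eLpNorm_le_of_ae_bound ((ae_restrict_iff' measurableSet_Ioo).2 (ae_of_all _ hb))
    _ < ⊤ := by
        refine ENNReal.mul_lt_top ?_ ENNReal.ofReal_lt_top
        rw [Measure.restrict_apply MeasurableSet.univ, univ_inter, Real.volume_Ioo]
        simp

/-! ### The witness -/

/-- The two solutions differ at `t = 1/2` (indeed at every `t > 0`): `v(1/2) = W/2` is not a.e.
zero. [folklore] -/
theorem not_zero_ae_eq_vel : ¬ ((0 : ℝ → ℝ³ → ℝ³) (1 / 2) =ᵐ[volume] vel (1 / 2)) := by
  intro h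
  refine not_ae_W_eq_zero_far 0 ?_
  filter_upwards [h] with x hx _
  have hx' : (1 / 2 : ℝ) • W x = 0 := by simpa [vel] using hx.symm
  exact (smul_eq_zero.1 hx').resolve_left (by norm_num)

/-- **The tree's rendering of ns.S20 is vacuous — the witness.** The statement below is, written
out in full (binder for binder), the body of the named fact `albritton_brue_colombo`
(`NSLerayHopf.lean`, cited to Albritton–Brué–Colombo 2022, Thm. 1.1 = arXiv Thm. 1.2): for every
`ν > 0` there are `T > 0`, a force `f` with `MemLqLp 1 2 f (Ioo 0 T)`, and two Leray–Hopf
solutions with force `f` and zero datum on `[0, T)` which differ at some `t ∈ (0, T)`. It is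
proved by the degenerate example of this file — `T = 1`, `f = p W + E_{k(·)}` (`force`), `u ≡ 0`
(`isLerayHopfOn_zero`), `v = t W` (`isLerayHopfOn_vel`), distinct at `t = 1/2`
(`not_zero_ae_eq_vel`) — and NOT by the Albritton–Brué–Colombo construction: it witnesses that
the rendering is weaker than the printed theorem, whose force lies in the Bochner space
`L¹_t L²_x(ℝ³ × (0,T))` (Def. 1.1) and is in particular measurable in time, whereas `MemLqLp`
sees only the slices of `f` and the force enters `IsLerayHopfOn` only through Bochner integrals in
time (junk `0` without measurability). Following the tree's precedent for this family of defects
(`WeakSolution.lean`, "Retired / corrected named facts"; `DistributionalToWeakCounterexample.lean`)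
and the review of p32345, the named fact `albritton_brue_colombo` is deliberately **not**
discharged here: it awaits retirement in favour of the rendering carrying
`AEStronglyMeasurable (uncurry f) (volume.restrict (Ioo 0 T ×ˢ univ))` (as `hopf_existence_torus`
already has for its force, and as the unit-viscosity fact `albritton_brue_colombo_unit` now does —
`NSLerayHopfABCScaling.lean`, `albritton_brue_colombo_unit_iff_forall_viscosity` for the
every-viscosity form), which stays an undischarged named fact — the true state of the
formalisation of Albritton–Brué–Colombo's theorem. [folklore] -/
theorem rendering_is_vacuous :
    ∀ ν : ℝ, 0 < ν →
      ∃ T : ℝ, 0 < T ∧ ∃ f : ℝ → ℝ³ → ℝ³, FluidPDE.MemLqLp 1 2 f (Ioo 0 T) ∧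
        ∃ u v : ℝ → ℝ³ → ℝ³, FluidPDE.IsLerayHopfOn T ν f 0 u ∧ FluidPDE.IsLerayHopfOn T ν f 0 v ∧
          ∃ t ∈ Ioo 0 T, ¬ (u t =ᵐ[volume] v t) := by
  intro ν _
  exact ⟨1, one_pos, force ν, memLqLp_force ν, 0, vel, isLerayHopfOn_zero ν, isLerayHopfOn_vel ν,
    1 / 2, ⟨by norm_num, by norm_num⟩, not_zero_ae_eq_vel⟩

/-- **The retired unit-viscosity rendering is equally vacuous**: the body of
`albritton_brue_colombo_unit` as first vendored (`NSLerayHopfABCScaling.lean`, p25167: the printed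
`ν = 1` statement in the same unguarded form, i.e. the case `ν = 1` of the body of
`albritton_brue_colombo`), written out in full, is the case `ν = 1` of `rendering_is_vacuous`.
The fact has since been restated with the clause
`AEStronglyMeasurable (uncurry f) (volume.restrict (Ioo 0 T ×ˢ univ))` on the force, under which
this example collapses (module docstring, "The faithful statement"); the statement below is the
retired rendering, kept as the record of why it was retired. Same caveat: a witness of the defect,
not a discharge of anything. [folklore] -/
theorem unit_rendering_is_vacuous :
    ∃ T : ℝ, 0 < T ∧ ∃ f : ℝ → ℝ³ → ℝ³, FluidPDE.MemLqLp 1 2 f (Ioo 0 T) ∧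
      ∃ u v : ℝ → ℝ³ → ℝ³, FluidPDE.IsLerayHopfOn T 1 f 0 u ∧ FluidPDE.IsLerayHopfOn T 1 f 0 v ∧
        ∃ t ∈ Ioo 0 T, ¬ (u t =ᵐ[volume] v t) :=
  rendering_is_vacuous 1 one_pos

end ABCVacuity

end Literature.Analysis.FluidPDE
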